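import Summits.QuantumFields.BalabanUV.Beta.D1BFx.WardJetsFromNoether

/-!
# `BalabanUV.Beta.D1BFx.WardJetsUnpacked` — road «BF-x» for binder row D1, slot (K), TB4 brick **K-TA4W** (staged companion 2 of the ONE module `WardJetsFromNoether`, filed only under the row owner's (R1)):
# the packed Ward relations of `WardJetsFromNoether` UNPACKED on `ν ⊕ μ` into the literal binder shapes
# `Kₛ·W₀ + K₀·Wₛ = 0`, `Qₛ·W₀ + Q₀·Wₛ = 0`, `Kₛₜ·W₀ + Kₛ·Wₜ + Kₜ·Wₛ + K₀·Wₛₜ = 0`, `Kₛₛ·W₀ + 2•(Kₛ·Wₛ) + K₀·Wₛₛ = 0`, … of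
# `MixedVarPackedHess.hessT_sliceTransfer_jets`, for jets ASSEMBLED from partial tables by the KKT chain rule

HONEST DEPENDENCY (cell records, verbatim): «continuum YM on T⁴ ⇐ BetaPertH ∧ nine spine estimates (0/9 proved); BetaPertH ⇐ (D1) ∧ (D4) ∧
CAP+tail; G-an2-4 gates asym, D1 and NE2/3/4.»  HONEST FRAMING (cell contract, verbatim): «discharging `BetaPertH` makes Bałaban's UV stability
UNCONDITIONAL — a real constructive-QFT result; it is NOT the continuum limit and NOT the Clay problem.»  THIS MODULE DISCHARGES NOTHING of (K),
of D1 or of the wall: [folklore] finite-dimensional matrix algebra over ABSTRACT data; no definition, no `def … : Prop`, nothing cited,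
0 sorry.  NOT D1, NOT BetaPertH, NOT continuum, NOT Clay.

ABSOLUTE RULE (cell charter, verbatim): «No internally-minted statement may enter as a cited fact. Every hypothesis is either kernel-proved in this
package or a verbatim quotation of a PUBLISHED theorem with page reference. The manuscript(s) under audit are NOT citable for their own disputed
steps — they are the thing under adjudication; programme-internal (2001/route/tribunal) claims are never citable.»

CONTENT (all [folklore]; `kkt K Q = fromBlocks K Qᵀ Q 0` is `Composition.kkt`, `fromRows` is Mathlib's).
* §1 BLOCK BOOKKEEPING beyond the module's §4 (used BY NAME): doubly weighted sums of `kkt`- and `fromRows x 0`-tables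
  (`sum_sum_smul_kkt`, `sum_sum_smul_fromRows_zero`), `oslot_fromRows_zero_apply`, the multiplier rows `kkt_mulVec_inr`.
* §2 ORDER ONE (the module's `ward₁` gives `aₛ`, `bₛ`): **`P1_packed_of_blocks`** — the packed [P1] from its field-row and multiplier-row halves when the generator has no table in the
  multiplier directions (`x₁ (inr m) = 0`: the gauge action does not depend on the multiplier).
* §3 ORDER TWO: **`ward₂`** — [P1], [P2] and the three field-row source conditions give
  `Kₛₜ·W₀ + Kₛ·Wₜ + Kₜ·Wₛ + K₀·Wₛₜ = 0 ∧ Qₛₜ·W₀ + Qₛ·Wₜ + Qₜ·Wₛ + Q₀·Wₛₜ = 0` (binders `aₛₜ`, `bₛₜ`) for the assembled second jets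
  `Kₛₜ := Σ_{k,l} r_s^k r_t^l•K₂ k l + Σ_k r_st^k•K₁ k` etc.; **`ward₂_diag`** — the `s = t` case in the `(2:ℝ)•` dress of `aₛₛ`∕`bₛₛ`.
* §4 THE `ᵀ`-BINDERS for honest (symmetric) Hessian tables: weighted sums of symmetric tables are symmetric (`transpose_sum_smul_of_symm`,
  `transpose_sum_sum_smul_of_symm`), hence `a0t…aₛₜt` are the one-sided relations rewritten (`ward_transpose₁`, `ward_transpose₂`).  The
  colourless∕parity-typed placement is NOT symmetric and is K-TA4C's business (`ColourLift.lift_rel…`), not this file's.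
NOT HERE: the source conditions themselves for a concrete inverse (file 3 `WardJetsCombSources`), periodisation, the cell's tables, letters.
Provenance: D1 formalisation swarm leaf seat `b2b-balaban-beta-d1-formalise-leaf-05` gen 11 (road «BF-x» brick K-TA4W), 2026-08-20.
-/

noncomputable section

namespace Summit.QuantumFields.BalabanUV.Beta.D1BFx.WardJetsUnpacked

open Matrix
open scoped BigOperators
open Literature.MathematicalPhysics.QuantumFieldTheory.Balaban1983to89.Beta.Composition (kkt)
open Summit.QuantumFields.BalabanUV.Beta.D1BFx.SliceTransferJetsMixed (kkt_add)
open Summit.QuantumFields.BalabanUV.Beta.D1BFx.WardJetsFromNoether (oslot oslot_apply packedWard₁ packedWard₂ kkt_mul_fromRows_zero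
  fromRows_eq_zero_iff fromRows_add_fromRows sum_smul_kkt sum_smul_fromRows_zero oslot_fromRows_zero_eq_zero kkt_mulVec_inl ward₁)

/-! ## §1 Block bookkeeping on `ν ⊕ μ` -/

section Blocks

variable {ν μ ρ : Type*} [Fintype ν] [Fintype μ]

omit [Fintype ν] [Fintype μ] in
/-- [folklore] Doubly weighted double sums of `kkt`-tables are `kkt` of the double sums. -/
theorem sum_sum_smul_kkt {ι : Type*} [Fintype ι] (c : ι → ι → ℝ) (K : ι → ι → Matrix ν ν ℝ) (Q : ι → ι → Matrix μ ν ℝ) :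
    ∑ k, ∑ l, c k l • kkt (K k l) (Q k l) = kkt (∑ k, ∑ l, c k l • K k l) (∑ k, ∑ l, c k l • Q k l) := by
  ext i j
  rcases i with i | i <;> rcases j with j | j <;> simp [kkt, Matrix.fromBlocks, Matrix.sum_apply]

omit [Fintype ν] [Fintype μ] in
/-- [folklore] Doubly weighted double sums of field-rows tables. -/
theorem sum_sum_smul_fromRows_zero {ι : Type*} [Fintype ι] (c : ι → ι → ℝ) (x : ι → ι → Matrix ν ρ ℝ) :
    ∑ k, ∑ l, c k l • fromRows (x k l) (0 : Matrix μ ρ ℝ) = fromRows (∑ k, ∑ l, c k l • x k l) (0 : Matrix μ ρ ℝ) := by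
  ext i a
  rcases i with i | i <;> simp [Matrix.sum_apply, Matrix.fromRows]

/-- [folklore] Entries of the `oslot` of a field-rows generator family: only the field components of the weight enter. -/
theorem oslot_fromRows_zero_apply (x : ν ⊕ μ → Matrix ν ρ ℝ) (w : ν ⊕ μ → ℝ) (j : ν ⊕ μ) (a : ρ) :
    oslot (fun k => fromRows (x k) (0 : Matrix μ ρ ℝ)) w j a = ∑ i : ν, w (Sum.inl i) * x j i a := by
  simp [oslot_apply, Fintype.sum_sum_type, Matrix.fromRows]

/-- [folklore] The multiplier rows of `kkt K₀ Q₀ *ᵥ r`: `Q₀ *ᵥ rᶠ` — the second KKT row (the prescribed coarse field). -/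
theorem kkt_mulVec_inr (K₀ : Matrix ν ν ℝ) (Q₀ : Matrix μ ν ℝ) (r : ν ⊕ μ → ℝ) (m : μ) :
    (kkt K₀ Q₀ *ᵥ r) (Sum.inr m) = (Q₀ *ᵥ fun j => r (Sum.inl j)) m := by
  simp [kkt, Matrix.mulVec, dotProduct, Matrix.fromBlocks, Fintype.sum_sum_type]

end Blocks

/-! ## §2 Order one: binders `aₛ`, `bₛ` (and `aₜ`, `bₜ`) for assembled first jets -/

section OrderOne

variable {ν μ ρ : Type*} [Fintype ν] [Fintype μ]

/-- [folklore] **THE PACKED [P1] FROM ITS TWO ROW BLOCKS.**  When the gauge action has no table in the multiplier directions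
(`x₁ (inr m) = 0`), the packed hypothesis [P1] at direction `k` is exactly: FIELD rows
`K₁ k·W₀ + K₀·x₁ k + (of fun j a ↦ Σ_{i:ν} (kkt K₀ Q₀) (inl i) k · x₁ (inl j) i a) = 0` (the `∂_k`-jet of `∇L·D = 0` with its
other-slot term: for a field direction `k = inl k′` the weight is column `k′` of `K₀`, for a multiplier direction `k = inr m` it is
row `m` of `Q₀`) and MULTIPLIER rows `Q₁ k·W₀ + Q₀·x₁ k = 0` (the `∂_k`-jet of `Q′·D = 0`). -/
theorem P1_packed_of_blocks (K₀ : Matrix ν ν ℝ) (Q₀ : Matrix μ ν ℝ) (K₁ : ν ⊕ μ → Matrix ν ν ℝ) (Q₁ : ν ⊕ μ → Matrix μ ν ℝ)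
    (W₀ : Matrix ν ρ ℝ) (x₁ : ν ⊕ μ → Matrix ν ρ ℝ) (hx : ∀ m : μ, x₁ (Sum.inr m) = 0) (k : ν ⊕ μ)
    (hK : K₁ k * W₀ + K₀ * x₁ k + Matrix.of (fun j a => ∑ i : ν, kkt K₀ Q₀ (Sum.inl i) k * x₁ (Sum.inl j) i a) = 0)
    (hQ : Q₁ k * W₀ + Q₀ * x₁ k = 0) :
    kkt (K₁ k) (Q₁ k) * fromRows W₀ (0 : Matrix μ ρ ℝ) + kkt K₀ Q₀ * fromRows (x₁ k) (0 : Matrix μ ρ ℝ)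
      + oslot (fun j => fromRows (x₁ j) (0 : Matrix μ ρ ℝ)) (fun i => kkt K₀ Q₀ i k) = 0 := by
  have hos : oslot (fun j => fromRows (x₁ j) (0 : Matrix μ ρ ℝ)) (fun i => kkt K₀ Q₀ i k)
      = fromRows (Matrix.of fun j a => ∑ i : ν, kkt K₀ Q₀ (Sum.inl i) k * x₁ (Sum.inl j) i a) (0 : Matrix μ ρ ℝ) := by
    ext j a
    rcases j with j | m
    · rw [oslot_fromRows_zero_apply, Matrix.fromRows_apply_inl, Matrix.of_apply]
    · rw [oslot_fromRows_zero_apply, Matrix.fromRows_apply_inr, Matrix.zero_apply]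
      exact Finset.sum_eq_zero fun i _ => by rw [hx m, Matrix.zero_apply, mul_zero]
  rw [hos, kkt_mul_fromRows_zero, kkt_mul_fromRows_zero, fromRows_add_fromRows, fromRows_add_fromRows, fromRows_eq_zero_iff]
  exact ⟨hK, by rw [add_zero]; exact hQ⟩

end OrderOne

/-! ## §3 Order two: binders `aₛₜ`, `bₛₜ`, `aₛₛ`, `bₛₛ`, … for assembled second jets -/

section OrderTwo

variable {ν μ ρ : Type*} [Fintype ν] [Fintype μ]

/-- [folklore] **(aₛₜ) AND (bₛₜ) FOR ASSEMBLED JETS.**  Tables `K₁, Q₁` (first partials), `K₂, Q₂` (second partials), generator tables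
`W₀, x₁, x₂`, base `K₀, Q₀`; hypotheses: packed [P1] for every direction and packed [P2] for every pair of directions; responses `rs`, `rt`
with vanishing FIELD KKT rows, second response `rst` with vanishing field rows of `kkt K₀ Q₀ *ᵥ rst + kkt Kₜ Qₜ *ᵥ rs`
(`Kₜ := Σ_l rt_l•K₁ l`, `Qₜ := Σ_l rt_l•Q₁ l` — the shape of `K₂ = −K(∂𝕄)K`).  Conclusion, with
`Kₛₜ := Σ_{k,l} rs_k rt_l•K₂ k l + Σ_k rst_k•K₁ k`, `Qₛₜ` likewise, `Wₛₜ := Σ_{k,l} rs_k rt_l•x₂ k l + Σ_k rst_k•x₁ k`: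
`Kₛₜ·W₀ + Kₛ·Wₜ + Kₜ·Wₛ + K₀·Wₛₜ = 0 ∧ Qₛₜ·W₀ + Qₛ·Wₜ + Qₜ·Wₛ + Q₀·Wₛₜ = 0`. -/
theorem ward₂ (K₀ : Matrix ν ν ℝ) (Q₀ : Matrix μ ν ℝ) (K₁ : ν ⊕ μ → Matrix ν ν ℝ) (Q₁ : ν ⊕ μ → Matrix μ ν ℝ)
    (K₂ : ν ⊕ μ → ν ⊕ μ → Matrix ν ν ℝ) (Q₂ : ν ⊕ μ → ν ⊕ μ → Matrix μ ν ℝ)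
    (W₀ : Matrix ν ρ ℝ) (x₁ : ν ⊕ μ → Matrix ν ρ ℝ) (x₂ : ν ⊕ μ → ν ⊕ μ → Matrix ν ρ ℝ)
    (hP1 : ∀ k, kkt (K₁ k) (Q₁ k) * fromRows W₀ (0 : Matrix μ ρ ℝ) + kkt K₀ Q₀ * fromRows (x₁ k) (0 : Matrix μ ρ ℝ)
      + oslot (fun j => fromRows (x₁ j) (0 : Matrix μ ρ ℝ)) (fun i => kkt K₀ Q₀ i k) = 0)
    (hP2 : ∀ k l, kkt (K₂ k l) (Q₂ k l) * fromRows W₀ (0 : Matrix μ ρ ℝ) + kkt (K₁ k) (Q₁ k) * fromRows (x₁ l) (0 : Matrix μ ρ ℝ)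
      + kkt (K₁ l) (Q₁ l) * fromRows (x₁ k) (0 : Matrix μ ρ ℝ) + kkt K₀ Q₀ * fromRows (x₂ k l) (0 : Matrix μ ρ ℝ)
      + oslot (fun j => fromRows (x₁ j) (0 : Matrix μ ρ ℝ)) (fun i => kkt (K₁ l) (Q₁ l) i k)
      + oslot (fun j => fromRows (x₂ l j) (0 : Matrix μ ρ ℝ)) (fun i => kkt K₀ Q₀ i k)
      + oslot (fun j => fromRows (x₂ k j) (0 : Matrix μ ρ ℝ)) (fun i => kkt K₀ Q₀ i l) = 0)
    (rs rt rst : ν ⊕ μ → ℝ)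
    (hs : ∀ i : ν, (kkt K₀ Q₀ *ᵥ rs) (Sum.inl i) = 0) (ht : ∀ i : ν, (kkt K₀ Q₀ *ᵥ rt) (Sum.inl i) = 0)
    (hst : ∀ i : ν, (kkt K₀ Q₀ *ᵥ rst + kkt (∑ l, rt l • K₁ l) (∑ l, rt l • Q₁ l) *ᵥ rs) (Sum.inl i) = 0) :
    (∑ k, ∑ l, (rs k * rt l) • K₂ k l + ∑ k, rst k • K₁ k) * W₀ + (∑ k, rs k • K₁ k) * (∑ l, rt l • x₁ l)
        + (∑ l, rt l • K₁ l) * (∑ k, rs k • x₁ k) + K₀ * (∑ k, ∑ l, (rs k * rt l) • x₂ k l + ∑ k, rst k • x₁ k) = 0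
    ∧ (∑ k, ∑ l, (rs k * rt l) • Q₂ k l + ∑ k, rst k • Q₁ k) * W₀ + (∑ k, rs k • Q₁ k) * (∑ l, rt l • x₁ l)
        + (∑ l, rt l • Q₁ l) * (∑ k, rs k • x₁ k) + Q₀ * (∑ k, ∑ l, (rs k * rt l) • x₂ k l + ∑ k, rst k • x₁ k) = 0 := by
  have hst' : oslot (fun j => fromRows (x₁ j) (0 : Matrix μ ρ ℝ))
      (kkt K₀ Q₀ *ᵥ rst + (∑ l, rt l • kkt (K₁ l) (Q₁ l)) *ᵥ rs) = 0 := by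
    rw [sum_smul_kkt]
    exact oslot_fromRows_zero_eq_zero x₁ _ hst
  have h := packedWard₂ (kkt K₀ Q₀) (fun k => kkt (K₁ k) (Q₁ k)) (fun k l => kkt (K₂ k l) (Q₂ k l)) (fromRows W₀ (0 : Matrix μ ρ ℝ))
    (fun k => fromRows (x₁ k) (0 : Matrix μ ρ ℝ)) (fun k l => fromRows (x₂ k l) (0 : Matrix μ ρ ℝ)) hP1 hP2 rs rt rst
    (fun l => oslot_fromRows_zero_eq_zero (x₂ l) _ hs) (fun k => oslot_fromRows_zero_eq_zero (x₂ k) _ ht) hst'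
  rw [sum_sum_smul_kkt, sum_smul_kkt, ← kkt_add, sum_smul_kkt, sum_smul_kkt, sum_smul_fromRows_zero, sum_smul_fromRows_zero,
    sum_sum_smul_fromRows_zero, sum_smul_fromRows_zero, fromRows_add_fromRows, add_zero, kkt_mul_fromRows_zero,
    kkt_mul_fromRows_zero, kkt_mul_fromRows_zero, kkt_mul_fromRows_zero, fromRows_add_fromRows, fromRows_add_fromRows,
    fromRows_add_fromRows, fromRows_eq_zero_iff] at h
  exact h

/-- [folklore] **(aₛₛ) AND (bₛₛ): the diagonal case in the `(2:ℝ)•` dress** of `hessT_sliceTransfer_jets`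
(`Kₛₛ·W₀ + 2•(Kₛ·Wₛ) + K₀·Wₛₛ = 0`, `Qₛₛ·W₀ + 2•(Qₛ·Wₛ) + Q₀·Wₛₛ = 0`): `ward₂` at `t = s`. -/
theorem ward₂_diag (K₀ : Matrix ν ν ℝ) (Q₀ : Matrix μ ν ℝ) (K₁ : ν ⊕ μ → Matrix ν ν ℝ) (Q₁ : ν ⊕ μ → Matrix μ ν ℝ)
    (K₂ : ν ⊕ μ → ν ⊕ μ → Matrix ν ν ℝ) (Q₂ : ν ⊕ μ → ν ⊕ μ → Matrix μ ν ℝ)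
    (W₀ : Matrix ν ρ ℝ) (x₁ : ν ⊕ μ → Matrix ν ρ ℝ) (x₂ : ν ⊕ μ → ν ⊕ μ → Matrix ν ρ ℝ)
    (hP1 : ∀ k, kkt (K₁ k) (Q₁ k) * fromRows W₀ (0 : Matrix μ ρ ℝ) + kkt K₀ Q₀ * fromRows (x₁ k) (0 : Matrix μ ρ ℝ)
      + oslot (fun j => fromRows (x₁ j) (0 : Matrix μ ρ ℝ)) (fun i => kkt K₀ Q₀ i k) = 0)
    (hP2 : ∀ k l, kkt (K₂ k l) (Q₂ k l) * fromRows W₀ (0 : Matrix μ ρ ℝ) + kkt (K₁ k) (Q₁ k) * fromRows (x₁ l) (0 : Matrix μ ρ ℝ)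
      + kkt (K₁ l) (Q₁ l) * fromRows (x₁ k) (0 : Matrix μ ρ ℝ) + kkt K₀ Q₀ * fromRows (x₂ k l) (0 : Matrix μ ρ ℝ)
      + oslot (fun j => fromRows (x₁ j) (0 : Matrix μ ρ ℝ)) (fun i => kkt (K₁ l) (Q₁ l) i k)
      + oslot (fun j => fromRows (x₂ l j) (0 : Matrix μ ρ ℝ)) (fun i => kkt K₀ Q₀ i k)
      + oslot (fun j => fromRows (x₂ k j) (0 : Matrix μ ρ ℝ)) (fun i => kkt K₀ Q₀ i l) = 0)
    (rs rss : ν ⊕ μ → ℝ) (hs : ∀ i : ν, (kkt K₀ Q₀ *ᵥ rs) (Sum.inl i) = 0)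
    (hss : ∀ i : ν, (kkt K₀ Q₀ *ᵥ rss + kkt (∑ l, rs l • K₁ l) (∑ l, rs l • Q₁ l) *ᵥ rs) (Sum.inl i) = 0) :
    (∑ k, ∑ l, (rs k * rs l) • K₂ k l + ∑ k, rss k • K₁ k) * W₀ + (2 : ℝ) • ((∑ k, rs k • K₁ k) * (∑ k, rs k • x₁ k))
        + K₀ * (∑ k, ∑ l, (rs k * rs l) • x₂ k l + ∑ k, rss k • x₁ k) = 0
    ∧ (∑ k, ∑ l, (rs k * rs l) • Q₂ k l + ∑ k, rss k • Q₁ k) * W₀ + (2 : ℝ) • ((∑ k, rs k • Q₁ k) * (∑ k, rs k • x₁ k))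
        + Q₀ * (∑ k, ∑ l, (rs k * rs l) • x₂ k l + ∑ k, rss k • x₁ k) = 0 := by
  obtain ⟨hK, hQ⟩ := ward₂ K₀ Q₀ K₁ Q₁ K₂ Q₂ W₀ x₁ x₂ hP1 hP2 rs rs rss hs hs hss
  refine ⟨?_, ?_⟩
  · rw [two_smul, ← add_assoc]; exact hK
  · rw [two_smul, ← add_assoc]; exact hQ

end OrderTwo

/-! ## §4 The `ᵀ`-binders for symmetric tables -/

section Transpose

variable {ν ρ : Type*}

/-- [folklore] A weighted sum of symmetric tables is symmetric. -/
theorem transpose_sum_smul_of_symm {ι : Type*} (s : Finset ι) (c : ι → ℝ) (K : ι → Matrix ν ν ℝ) (hK : ∀ k, (K k)ᵀ = K k) :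
    (∑ k ∈ s, c k • K k)ᵀ = ∑ k ∈ s, c k • K k := by
  rw [Matrix.transpose_sum]
  exact Finset.sum_congr rfl fun k _ => by rw [Matrix.transpose_smul, hK k]

/-- [folklore] A doubly weighted double sum of symmetric tables is symmetric. -/
theorem transpose_sum_sum_smul_of_symm {ι : Type*} [Fintype ι] (c : ι → ι → ℝ) (K : ι → ι → Matrix ν ν ℝ)
    (hK : ∀ k l, (K k l)ᵀ = K k l) : (∑ k, ∑ l, c k l • K k l)ᵀ = ∑ k, ∑ l, c k l • K k l := by
  rw [Matrix.transpose_sum]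
  exact Finset.sum_congr rfl fun k _ => transpose_sum_smul_of_symm _ _ _ (hK k)

variable [Fintype ν]

/-- [folklore] **`aₛt` from `aₛ`** for symmetric base and jet (honest Hessians): `Kₛᵀ·W₀ + K₀ᵀ·Wₛ = 0`. -/
theorem ward_transpose₁ (K₀ Kₛ : Matrix ν ν ℝ) (W₀ Wₛ : Matrix ν ρ ℝ) (h0 : K₀ᵀ = K₀) (hs : Kₛᵀ = Kₛ)
    (h : Kₛ * W₀ + K₀ * Wₛ = 0) : Kₛᵀ * W₀ + K₀ᵀ * Wₛ = 0 := by
  rwa [h0, hs]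

/-- [folklore] **`aₛₜt` from `aₛₜ`** (and `aₛₛt`∕`aₜₜt` at `t = s`) for symmetric tables:
`Kₛₜᵀ·W₀ + Kₛᵀ·Wₜ + Kₜᵀ·Wₛ + K₀ᵀ·Wₛₜ = 0`. -/
theorem ward_transpose₂ (K₀ Kₛ Kₜ Kₛₜ : Matrix ν ν ℝ) (W₀ Wₛ Wₜ Wₛₜ : Matrix ν ρ ℝ) (h0 : K₀ᵀ = K₀) (hs : Kₛᵀ = Kₛ)
    (ht : Kₜᵀ = Kₜ) (hst : Kₛₜᵀ = Kₛₜ) (h : Kₛₜ * W₀ + Kₛ * Wₜ + Kₜ * Wₛ + K₀ * Wₛₜ = 0) :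
    Kₛₜᵀ * W₀ + Kₛᵀ * Wₜ + Kₜᵀ * Wₛ + K₀ᵀ * Wₛₜ = 0 := by
  rwa [h0, hs, ht, hst]

/-- [folklore] **`aₛₛt` from `aₛₛ`** in the `(2:ℝ)•` dress. -/
theorem ward_transpose₂_diag (K₀ Kₛ Kₛₛ : Matrix ν ν ℝ) (W₀ Wₛ Wₛₛ : Matrix ν ρ ℝ) (h0 : K₀ᵀ = K₀) (hs : Kₛᵀ = Kₛ)
    (hss : Kₛₛᵀ = Kₛₛ) (h : Kₛₛ * W₀ + (2 : ℝ) • (Kₛ * Wₛ) + K₀ * Wₛₛ = 0) :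
    Kₛₛᵀ * W₀ + (2 : ℝ) • (Kₛᵀ * Wₛ) + K₀ᵀ * Wₛₛ = 0 := by
  rwa [h0, hs, hss]

end Transpose

end Summit.QuantumFields.BalabanUV.Beta.D1BFx.WardJetsUnpacked

end
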